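import Mathlib
import Literature.Analysis.FunctionSpaces.DistributionalConstancy
import Summits.NavierStokesRegularity.NavierStokesRegularity.Theorems.EulerZoomLiouvillePowerGaugeEulerLiouvilleDistributionallyAffine
import HarnessLib

/-!
# Crux `EulerZoomLiouville.PowerGaugeEulerLiouville` (stmt-NavierStokesRegularity-19832), stub `stub_nonSelfSimilarRest`:
# the `N`-th ORDER du Bois-Reymond lemma in one variable — `E^{(N+1)} = 0` in `𝒟'((a,b))` ⇒ `E` is a.e. a polynomial of degree `≤ N`

Helper file (theorems only; `--supports stmt-NavierStokesRegularity-19832`; def-free; pure analysis).  Hand leafhand-ns-eulerzoomliouville-10 g4.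
Step 1/2 of the `𝒟'` form of hand 11 g0's polynomial-in-time stratum (`…PolynomialTimePast`, `PolyPast.ae_eq_zero_of_gauge_of_aePolynomialPast`:
`u = Σ_{k≤N} τ^k U_k` a.e. ⇒ trivial): the one-variable lemma that turns `∫∫ θ^{(N+1)}(t)⟪u, Φ⟫ = 0` into polynomial pairings on every time window
(the case `N = 1` is `DistAffine.exists_affine_of_forall_setIntegral_deriv_deriv_mul_eq_zero`, hand 10 g4).  STEP 2/2 (NOT in this file, next hand):
Lagrange interpolation of `N+1` good slices (`Lagrange.eq_interpolate`, `Polynomial.eval_eq_sum_range'`) assembling the fields `U_k` exactly as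
`DistAffine.exists_ae_eq_affine` does for `N = 1`.

* `DistPoly.setIntegral_deriv_mul_eq_neg` — `∫_{(a,b)} φ' f = −∫_{(a,b)} φ f'` for `φ ∈ C_c^∞((a,b))`, `f` smooth (no boundary terms);
* `DistPoly.setIntegral_iterate_deriv_mul_eq` — `∫_{(a,b)} φ^{(n)} f = (−1)^n ∫_{(a,b)} φ f^{(n)}`;
* `DistPoly.iterate_deriv_pow_div_factorial` — `(t^n/n!)^{(n)} = 1`; `DistPoly.iterate_deriv_sub_const_mul` — linearity of `deriv^[n]` on smooth functions;
* `DistPoly.exists_poly_of_forall_setIntegral_iterate_deriv_mul_eq_zero` — **THE LEMMA**: `E ∈ L¹((a,b))`, `∫_{(a,b)} η^{(N+1)} E = 0` for all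
  `η ∈ C_c^∞((a,b))` ⇒ `E(t) = Σ_{k≤N} e_k t^k` a.e. on `(a,b)` (induction on `N`: the functional `φ ↦ ∫ φ^{(N+1)} E` equals `κ ∫ φ`, and
  `E − κ(−1)^{N+1} t^{N+1}/(N+1)!` satisfies the order-`N` hypothesis by `N+1` integrations by parts).

WHAT THIS IS NOT: nothing about Euler or Navier–Stokes; not a proof of any stub. [folklore; Hörmander ALPDO I Thm 3.1.4; Brezis2011 Lemma 8.1]
-/

noncomputable section

-- flat `Theorems/<Route><Decl>…` files of one crux share the namespace of the crux (tree convention)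
set_option linter.dupNamespace false

open MeasureTheory Set Filter Topology Metric Function TopologicalSpace Finset
open scoped ContDiff

namespace Summit.NavierStokesRegularity.NavierStokesRegularity.Theorems.PowerGaugeEulerLiouville

open Literature.Analysis Literature.Analysis.FunctionSpaces

namespace DistPoly

/-! ## 1. Integration by parts against test functions on `(a,b)` -/

/-- `∫_{(a,b)} φ'(t) f(t) dt = −∫_{(a,b)} φ(t) f'(t) dt` for a smooth `φ` with `tsupport φ ⊆ (a,b)` and a smooth `f`. [folklore] -/
theorem setIntegral_deriv_mul_eq_neg {a b : ℝ} (hab : a < b) {φ f : ℝ → ℝ} (hφ : ContDiff ℝ ∞ φ)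
    (hφs : tsupport φ ⊆ Set.Ioo a b) (hf : ContDiff ℝ ∞ f) :
    ∫ t in Set.Ioo a b, deriv φ t * f t = -∫ t in Set.Ioo a b, φ t * deriv f t := by
  have hφa : φ a = 0 := image_eq_zero_of_notMem_tsupport fun h => (lt_irrefl a) (hφs h).1
  have hφb : φ b = 0 := image_eq_zero_of_notMem_tsupport fun h => (lt_irrefl b) (hφs h).2
  have hdφ : Differentiable ℝ φ := hφ.differentiable (by simp)
  have hdf : Differentiable ℝ f := hf.differentiable (by simp)
  have hparts := intervalIntegral.integral_mul_deriv_eq_deriv_mul (a := a) (b := b) (u := f) (u' := deriv f) (v := φ) (v' := deriv φ)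
    (fun x _ => (hdf x).hasDerivAt) (fun x _ => (hdφ x).hasDerivAt)
    ((hf.continuous_deriv (by simp)).intervalIntegrable _ _) ((hφ.continuous_deriv (by simp)).intervalIntegrable _ _)
  rw [hφa, hφb, mul_zero, mul_zero, sub_zero, zero_sub] at hparts
  have e1 : (fun t => deriv φ t * f t) = fun t => f t * deriv φ t := funext fun t => mul_comm _ _
  have e2 : (fun t => φ t * deriv f t) = fun t => deriv f t * φ t := funext fun t => mul_comm _ _
  rw [← integral_Ioc_eq_integral_Ioo, ← intervalIntegral.integral_of_le hab.le, e1, hparts, e2,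
    ← integral_Ioc_eq_integral_Ioo, ← intervalIntegral.integral_of_le hab.le]

/-- `n`-fold integration by parts: `∫_{(a,b)} φ^{(n)} f = (−1)^n ∫_{(a,b)} φ f^{(n)}` for `φ ∈ C_c^∞((a,b))`, `f` smooth. [folklore] -/
theorem setIntegral_iterate_deriv_mul_eq {a b : ℝ} (hab : a < b) (n : ℕ) :
    ∀ {φ f : ℝ → ℝ}, ContDiff ℝ ∞ φ → tsupport φ ⊆ Set.Ioo a b → ContDiff ℝ ∞ f →
      ∫ t in Set.Ioo a b, deriv^[n] φ t * f t = (-1) ^ n * ∫ t in Set.Ioo a b, φ t * deriv^[n] f t := by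
  induction n with
  | zero => intro φ f _ _ _; simp
  | succ n ih =>
    intro φ f hφ hφs hf
    have hφ' : ContDiff ℝ ∞ (deriv φ) := hφ.deriv'
    have hfn : ContDiff ℝ ∞ (deriv^[n] f) := hf.iterate_deriv n
    rw [Function.iterate_succ_apply, ih hφ' (tsupport_deriv_subset.trans hφs) hf, setIntegral_deriv_mul_eq_neg hab hφ hφs hfn,
      Function.iterate_succ_apply' deriv n f, pow_succ]
    ring

/-! ## 2. Elementary calculus of `deriv^[n]` -/

/-- `deriv^[n] (t ↦ t^n / n!) = 1`. [folklore] -/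
theorem iterate_deriv_pow_div_factorial (n : ℕ) : deriv^[n] (fun t : ℝ => t ^ n / (n.factorial : ℝ)) = fun _ => 1 := by
  induction n with
  | zero => funext t; simp
  | succ n ih =>
    rw [Function.iterate_succ_apply]
    have hd : deriv (fun t : ℝ => t ^ (n + 1) / ((n + 1).factorial : ℝ)) = fun t : ℝ => t ^ n / (n.factorial : ℝ) := by
      funext t
      rw [deriv_div_const, deriv_pow_field, Nat.factorial_succ]
      push_cast
      have hn : (n.factorial : ℝ) ≠ 0 := by positivity
      field_simp
    rw [hd, ih]

/-- `t ↦ t^n / n!` is smooth. [folklore] -/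
theorem contDiff_pow_div_factorial (n : ℕ) : ContDiff ℝ ∞ (fun t : ℝ => t ^ n / (n.factorial : ℝ)) :=
  (contDiff_id.pow n).div_const _

/-- Linearity of `deriv^[n]` on smooth functions: `(φ − m ψ)^{(n)} = φ^{(n)} − m ψ^{(n)}`. [folklore] -/
theorem iterate_deriv_sub_const_mul (n : ℕ) : ∀ {φ ψ : ℝ → ℝ} (m : ℝ), ContDiff ℝ ∞ φ → ContDiff ℝ ∞ ψ →
    deriv^[n] (fun t => φ t - m * ψ t) = fun t => deriv^[n] φ t - m * deriv^[n] ψ t := by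
  induction n with
  | zero => intro φ ψ m _ _; funext t; simp
  | succ n ih =>
    intro φ ψ m hφ hψ
    have hd : deriv (fun t => φ t - m * ψ t) = fun t => deriv φ t - m * deriv ψ t := by
      funext t
      have h1 : DifferentiableAt ℝ φ t := (hφ.differentiable (by simp)) t
      have h2 : DifferentiableAt ℝ ψ t := (hψ.differentiable (by simp)) t
      rw [deriv_fun_sub h1 (h2.const_mul m), deriv_const_mul m h2]
    rw [Function.iterate_succ_apply, hd, ih m hφ.deriv' hψ.deriv', Function.iterate_succ_apply, Function.iterate_succ_apply]

/-- Iterated derivatives of a compactly supported function are compactly supported. [folklore] -/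
theorem hasCompactSupport_iterate_deriv {φ : ℝ → ℝ} (h : HasCompactSupport φ) : ∀ n : ℕ, HasCompactSupport (deriv^[n] φ) := by
  intro n
  induction n with
  | zero => simpa using h
  | succ n ih => rw [Function.iterate_succ_apply']; exact ih.deriv

/-! ## 3. The `N`-th order lemma -/

/-- **`E^{(N+1)} = 0` IN `𝒟'((a,b))` IMPLIES `E` IS A.E. A POLYNOMIAL OF DEGREE `≤ N`.**  If `E` is integrable on `(a, b)` and
`∫_{(a,b)} η^{(N+1)} E = 0` for every smooth compactly supported `η` with `tsupport η ⊆ (a, b)`, then there are coefficients `e₀, …, e_N` with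
`E(t) = Σ_{k ≤ N} e_k t^k` a.e. on `(a, b)` (Hörmander, ALPDO I, Thm 3.1.4, for distributions). [cite: Brezis2011, Lemma 8.1] -/
theorem exists_poly_of_forall_setIntegral_iterate_deriv_mul_eq_zero {a b : ℝ} (N : ℕ) :
    ∀ {E : ℝ → ℝ}, IntegrableOn E (Set.Ioo a b) →
      (∀ η : ℝ → ℝ, ContDiff ℝ ∞ η → HasCompactSupport η → tsupport η ⊆ Set.Ioo a b →
        ∫ t in Set.Ioo a b, deriv^[N + 1] η t * E t = 0) →
      ∃ e : ℕ → ℝ, ∀ᵐ t ∂(volume.restrict (Set.Ioo a b)), E t = ∑ k ∈ range (N + 1), e k * t ^ k := by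
  rcases le_or_gt b a with hba | hab
  · intro E _ _
    refine ⟨fun _ => 0, ?_⟩
    rw [Set.Ioo_eq_empty_of_le hba, Measure.restrict_empty, ae_zero]
    exact eventually_bot
  induction N with
  | zero =>
    intro E hE h
    obtain ⟨c, hc⟩ := ae_eq_const_of_forall_setIntegral_deriv_mul_eq_zero hE (fun η hη hηc hηs => by
      simpa only [zero_add, Function.iterate_one] using h η hη hηc hηs)
    refine ⟨fun _ => c, ?_⟩
    filter_upwards [hc] with t ht
    simp [ht]
  | succ N ih =>
    intro E hE h
    obtain ⟨ψ, hψs, hψc, hψsupp, hψ1⟩ := exists_contDiff_tsupport_subset_Ioo_integral_eq_one hab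
    obtain ⟨a₁, b₁, ha₁, -, hb₁, hψz⟩ := exists_Icc_subset_Ioo_of_tsupport_subset hab hψc hψsupp
    set κ : ℝ := ∫ t in Set.Ioo a b, deriv^[N + 1] ψ t * E t with hκ
    -- Step 1: `∫ φ^{(N+2)} E = (∫ φ) κ` for every test `φ` on `(a,b)`
    -- adapted from Literature/Analysis/FunctionSpaces/DistributionalConstancy.lean (Brezis' construction)
    have hφE : ∀ φ : ℝ → ℝ, ContDiff ℝ ∞ φ → HasCompactSupport φ → tsupport φ ⊆ Set.Ioo a b →
        ∫ t in Set.Ioo a b, deriv^[N + 1] φ t * E t = (∫ t, φ t) * κ := by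
      intro φ hφs hφc hφsupp
      obtain ⟨a₂, b₂, ha₂, -, hb₂, hφz⟩ := exists_Icc_subset_Ioo_of_tsupport_subset hab hφc hφsupp
      set m : ℝ := ∫ t, φ t with hm
      set g : ℝ → ℝ := fun t => φ t - m * ψ t with hg
      have hgs : ContDiff ℝ ∞ g := hφs.sub (contDiff_const.mul hψs)
      have hgcont : Continuous g := hgs.continuous
      set a' : ℝ := (a + min a₁ a₂) / 2 with ha'
      set b' : ℝ := (b + max b₁ b₂) / 2 with hb'
      have haa' : a < a' := by rw [ha']; have := lt_min ha₁ ha₂; linarith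
      have hb'b : b' < b := by rw [hb']; have := max_lt hb₁ hb₂; linarith
      have hgz : ∀ t, g t ≠ 0 → t ∈ Set.Ioo a' b' := fun t ht => by
        have h' : φ t ≠ 0 ∨ ψ t ≠ 0 := by
          by_contra hcon
          simp only [not_or, not_not] at hcon
          exact ht (by simp only [hg, hcon.1, hcon.2, mul_zero, sub_zero])
        have hmin : min a₁ a₂ ≤ t ∧ t ≤ max b₁ b₂ := by
          rcases h' with h' | h'
          · exact ⟨(min_le_right _ _).trans (hφz t h').1, (hφz t h').2.trans (le_max_right _ _)⟩
          · exact ⟨(min_le_left _ _).trans (hψz t h').1, (hψz t h').2.trans (le_max_left _ _)⟩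
        have h1 := lt_min ha₁ ha₂
        have h2 := max_lt hb₁ hb₂
        constructor
        · rw [ha']; linarith [hmin.1]
        · rw [hb']; linarith [hmin.2]
      have hφi : Integrable φ volume := hφs.continuous.integrable_of_hasCompactSupport hφc
      have hψi : Integrable ψ volume := hψs.continuous.integrable_of_hasCompactSupport hψc
      have hg0 : ∫ t, g t = 0 := by
        simp only [hg]
        rw [integral_sub hφi (hψi.const_mul m), MeasureTheory.integral_const_mul, hψ1, mul_one, sub_self]
      set η : ℝ → ℝ := fun t => ∫ s in a..t, g s with hη
      have hηs : ContDiff ℝ ∞ η := contDiff_primitive hgs a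
      have hηd : ∀ t, HasDerivAt η (g t) t := fun t => (hgcont.integral_hasStrictDerivAt a t).hasDerivAt
      have hηz : ∀ t, t ∉ Set.Ioo a' b' → η t = 0 := fun t ht => by
        refine primitive_eq_zero_of_integral_eq_zero haa'.le hgz hg0 t ?_
        simp only [Set.mem_Ioo, not_and_or, not_lt] at ht
        exact ht
      have hηsub : tsupport η ⊆ Set.Icc a' b' :=
        closure_minimal (fun t ht => by
          by_contra h'
          exact ht (hηz t fun h'' => h' (Set.Ioo_subset_Icc_self h''))) isClosed_Icc
      have hηc : HasCompactSupport η :=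
        HasCompactSupport.of_support_subset_isCompact isCompact_Icc ((subset_tsupport η).trans hηsub)
      have hηsupp : tsupport η ⊆ Set.Ioo a b := hηsub.trans (Set.Icc_subset_Ioo haa' hb'b)
      have key := h η hηs hηc hηsupp
      have hderiv : deriv η = g := funext fun t => (hηd t).deriv
      have hderiv2 : deriv^[N + 1 + 1] η = fun t => deriv^[N + 1] φ t - m * deriv^[N + 1] ψ t := by
        rw [Function.iterate_succ_apply, hderiv]
        exact iterate_deriv_sub_const_mul (N + 1) m hφs hψs
      rw [hderiv2] at key
      have hφ'Ei : IntegrableOn (fun t => deriv^[N + 1] φ t * E t) (Set.Ioo a b) :=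
        integrableOn_continuous_mul_of_hasCompactSupport hE (hφs.iterate_deriv (N + 1)).continuous (hasCompactSupport_iterate_deriv hφc (N + 1))
      have hψ'Ei : IntegrableOn (fun t => deriv^[N + 1] ψ t * E t) (Set.Ioo a b) :=
        integrableOn_continuous_mul_of_hasCompactSupport hE (hψs.iterate_deriv (N + 1)).continuous (hasCompactSupport_iterate_deriv hψc (N + 1))
      have hsplit : ∫ t in Set.Ioo a b, (deriv^[N + 1] φ t - m * deriv^[N + 1] ψ t) * E t =
          (∫ t in Set.Ioo a b, deriv^[N + 1] φ t * E t) - m * ∫ t in Set.Ioo a b, deriv^[N + 1] ψ t * E t := by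
        rw [← MeasureTheory.integral_const_mul, ← integral_sub hφ'Ei (hψ'Ei.const_mul m)]
        exact integral_congr_ae (Eventually.of_forall fun t => by simp only; ring)
      rw [hsplit, sub_eq_zero] at key
      rw [key]
    -- Step 2: subtract the monomial `Q(t) = κ (−1)^{N+2} t^{N+2}/(N+2)!`
    set q : ℝ := κ * (-1) ^ (N + 1) with hq
    set Q : ℝ → ℝ := fun t => q * (t ^ (N + 1) / ((N + 1).factorial : ℝ)) with hQ
    have hQs : ContDiff ℝ ∞ Q := contDiff_const.mul (contDiff_pow_div_factorial (N + 1))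
    have hQi : IntegrableOn Q (Set.Ioo a b) :=
      (hQs.continuous.integrableOn_Icc (μ := volume) (a := a) (b := b)).mono_set Set.Ioo_subset_Icc_self
    have hQN : deriv^[N + 1] Q = fun _ => q := by
      have e : Q = fun t => q * (fun t : ℝ => t ^ (N + 1) / ((N + 1).factorial : ℝ)) t := rfl
      have h1 : ∀ n : ℕ, ∀ f : ℝ → ℝ, ContDiff ℝ ∞ f → deriv^[n] (fun t => q * f t) = fun t => q * deriv^[n] f t := by
        intro n
        induction n with
        | zero => intro f _; funext t; simp
        | succ n ihn =>
          intro f hf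
          have hd : deriv (fun t => q * f t) = fun t => q * deriv f t := by
            funext t
            exact deriv_const_mul q ((hf.differentiable (by simp)) t)
          rw [Function.iterate_succ_apply, hd, ihn (deriv f) hf.deriv', Function.iterate_succ_apply]
      rw [e, h1 (N + 1) _ (contDiff_pow_div_factorial (N + 1)), iterate_deriv_pow_div_factorial]
      funext t; simp
    have hE₁ : IntegrableOn (fun t => E t - Q t) (Set.Ioo a b) := hE.sub hQi
    have h1 : ∀ φ : ℝ → ℝ, ContDiff ℝ ∞ φ → HasCompactSupport φ → tsupport φ ⊆ Set.Ioo a b →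
        ∫ t in Set.Ioo a b, deriv^[N + 1] φ t * (E t - Q t) = 0 := by
      intro φ hφs hφc hφsupp
      have hφ'Ei : IntegrableOn (fun t => deriv^[N + 1] φ t * E t) (Set.Ioo a b) :=
        integrableOn_continuous_mul_of_hasCompactSupport hE (hφs.iterate_deriv (N + 1)).continuous (hasCompactSupport_iterate_deriv hφc (N + 1))
      have hφ'Qi : IntegrableOn (fun t => deriv^[N + 1] φ t * Q t) (Set.Ioo a b) :=
        integrableOn_continuous_mul_of_hasCompactSupport hQi (hφs.iterate_deriv (N + 1)).continuous (hasCompactSupport_iterate_deriv hφc (N + 1))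
      have e1 : ∫ t in Set.Ioo a b, deriv^[N + 1] φ t * (E t - Q t) =
          (∫ t in Set.Ioo a b, deriv^[N + 1] φ t * E t) - ∫ t in Set.Ioo a b, deriv^[N + 1] φ t * Q t := by
        rw [← integral_sub hφ'Ei hφ'Qi]
        exact integral_congr_ae (Eventually.of_forall fun t => by simp only; ring)
      have hφab : ∫ t in Set.Ioo a b, φ t * q = (∫ t, φ t) * q := by
        rw [integral_mul_const]
        congr 1
        exact setIntegral_eq_integral_of_forall_compl_eq_zero fun t ht =>
          image_eq_zero_of_notMem_tsupport fun h' => ht (hφsupp h')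
      rw [e1, hφE φ hφs hφc hφsupp, setIntegral_iterate_deriv_mul_eq hab (N + 1) hφs hφsupp hQs, hQN, hφab, hq]
      have hsq : (-1 : ℝ) ^ (N + 1) * (-1) ^ (N + 1) = 1 := by
        rw [← mul_pow]; norm_num
      linear_combination (-(∫ t, φ t) * κ) * hsq
    obtain ⟨e, he⟩ := ih hE₁ h1
    refine ⟨fun k => if k = N + 1 then q / ((N + 1).factorial : ℝ) else e k, ?_⟩
    filter_upwards [he] with t ht
    rw [Finset.sum_range_succ, if_pos rfl]
    have hsum : ∑ k ∈ range (N + 1), (if k = N + 1 then q / ((N + 1).factorial : ℝ) else e k) * t ^ k =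
        ∑ k ∈ range (N + 1), e k * t ^ k := by
      refine Finset.sum_congr rfl fun k hk => ?_
      have hk' : k ≠ N + 1 := by
        have := Finset.mem_range.1 hk
        omega
      rw [if_neg hk']
    rw [hsum, ← ht]
    simp only [hQ]
    ring

end DistPoly

end Summit.NavierStokesRegularity.NavierStokesRegularity.Theorems.PowerGaugeEulerLiouville

end
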